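import Summits.HodgeConjecture.HodgeConjecture.Theorems.EightfoldBlochSeedsChernCharacterOnBettiAnalytificationFrames
import HarnessLib

/-!
# K1 (analytification bridge), step 4: sections expand in frames under ANY comparison map;
# two comparison data agree through the frame-matching fibre map (uniqueness of `u^an`, algebraic half)

Route `EightfoldBlochSeeds` / item `stmt-HodgeConjecture-19780` (`ChernCharacterOnBetti`), helper
(`--supports`). HONEST FRAMING: nothing here proves 19780 / 18880 / 18882 / 18883 / H2 / HC_AV / HC;
no definition, no named fact.

WHAT. Let `α_U : Γ(F, U) → (P ↦ V P)` be ANY family of comparison maps of an `𝒪_X`-module `F` into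
fibres `V P` (complex vector spaces) over the complex points, additive, `𝒪_X`-linear
(`α(f • σ)(P) = f(P) • α(σ)(P)`) and restriction-compatible — the algebraic fields of Serre's
`α : F' → F^h` (GAGA §3 n°9 Déf. 2; the tree's `IsAnalytifiedVectorBundle`, and the conclusion of
`exists_topologicalAnalytification`). Then:

* `comparison_sum` — `α` is additive on finite sums;
* `comparison_expand` — **sections expand in frames**: for an algebraic frame `s` over `U ∋ P` and
  `σ ∈ Γ(F, U')`, `α(σ)(P) = Σ_k σₛ,ₖ(P) • α(s_k)(P)` with the EVALUATED COORDINATES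
  `σₛ,ₖ(P)` of step 1 (`eval_repr_…`) — so `α` is determined on `U'(ℂ) ∩ U(ℂ)` by its values on the
  frame;
* `comparison_eq_of_frame` — **uniqueness of `u^an` (algebraic half of the independence of the
  analytification from the datum)**: if `β` is a second such family into fibres `W P` and
  `Φ : V P →ₗ W P` matches `α(s_k)(P) ↦ β(s_k)(P)` on ONE frame at `P`, then `Φ (α(σ)(P)) = β(σ)(P)`
  for every section `σ` over every open containing `P` (Serre: `φ ↦ φ^h` is determined by frames;
  the tree's `IsAnalytifiedHom.eq_of_isFinLocallyFreeOn` is the same rigidity for a fixed target).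

What this leaves for the independence of the Betti Chern classes from the datum: the CONTINUITY of
the frame-matching fibrewise isomorphism between two topological analytifications (then
`ComplexVectorBundle.chernClassR_congr`). [cite: SerreGAGA1956, §3 n°9 Déf. 2 and Prop. 10]
-/

noncomputable section

-- single-problem summit (Problem = Summit): the mandated namespace repeats `HodgeConjecture`.
set_option linter.dupNamespace false

open CategoryTheory AlgebraicGeometry
open Literature.AlgebraicGeometry.Motives Literature.AlgebraicGeometry.HodgeTheory

namespace Summit.HodgeConjecture.HodgeConjecture.Theorems

variable {X : SchemeOver ℂ} {F : X.left.Modules} {r : ℕ}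
  {V : ComplexPoints X → Type*} [∀ P, AddCommGroup (V P)] [∀ P, Module ℂ (V P)]
  {W : ComplexPoints X → Type*} [∀ P, AddCommGroup (W P)] [∀ P, Module ℂ (W P)]

omit [∀ P, Module ℂ (V P)] in
/-- An additive comparison map is additive on finite sums. [cite: SerreGAGA1956, §3 n°9 Déf. 2] -/
theorem comparison_sum (α : ∀ U : X.left.Opens, Γ(F, U) → ∀ P : ComplexPoints X, V P)
    (hadd : ∀ (U : X.left.Opens) (σ τ : Γ(F, U)) (P : ComplexPoints X),
      α U (σ + τ) P = α U σ P + α U τ P)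
    (U : X.left.Opens) (P : ComplexPoints X) {ι : Type*} (S : Finset ι) (σ : ι → Γ(F, U)) :
    α U (∑ k ∈ S, σ k) P = ∑ k ∈ S, α U (σ k) P := by
  classical
  have h0 : α U 0 P = 0 := by
    have h := hadd U 0 0 P
    rw [add_zero] at h
    exact left_eq_add.mp h
  induction S using Finset.induction_on with
  | empty => simp only [Finset.sum_empty, h0]
  | insert a S ha ih => rw [Finset.sum_insert ha, Finset.sum_insert ha, hadd, ih]

/-- **Sections expand in frames under a comparison map**: for `α` additive, `𝒪_X`-linear and
restriction-compatible, an algebraic frame `s` of `F` over `U`, a section `σ ∈ Γ(F, U')` and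
`P ∈ (U' ∩ U)(ℂ)`: `α(σ)(P) = Σ_k σₛ,ₖ(P) • α(s_k)(P)`, where `σₛ,ₖ(P)` are the evaluated
coordinates of `σ|_{U' ∩ U}` in the frame. [cite: SerreGAGA1956, §3 n°9 Déf. 2] -/
theorem comparison_expand (α : ∀ U : X.left.Opens, Γ(F, U) → ∀ P : ComplexPoints X, V P)
    (hadd : ∀ (U : X.left.Opens) (σ τ : Γ(F, U)) (P : ComplexPoints X),
      α U (σ + τ) P = α U σ P + α U τ P)
    (hsmul : ∀ (U : X.left.Opens) (f : Γ(X.left, U)) (σ : Γ(F, U)) (P : ComplexPoints X)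
      (h : P.pt ∈ U), α U (f • σ) P = P.eval U h f • α U σ P)
    (hres : ∀ (U W : X.left.Opens) (hWU : W ≤ U) (σ : Γ(F, U)) (P : ComplexPoints X), P.pt ∈ W →
      α W (F.presheaf.map (homOfLE hWU).op σ) P = α U σ P)
    {U U' : X.left.Opens} {s : Fin r → Γ(F, U)} (hs : IsSectionFrame F U s) (σ : Γ(F, U'))
    {P : ComplexPoints X} (h' : P.pt ∈ U') (h : P.pt ∈ U) :
    α U' σ P = ∑ k, AlgPoints.evalOrZero (U' ⊓ U)
        ((hs.of_le inf_le_right).basis.repr (F.presheaf.map (homOfLE inf_le_left).op σ) k) P •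
      α U (s k) P := by
  have hP : P.pt ∈ U' ⊓ U := ⟨h', h⟩
  set b := (hs.of_le (inf_le_right : U' ⊓ U ≤ U)).basis with hb
  rw [← hres U' (U' ⊓ U) inf_le_left σ P hP]
  conv_lhs => rw [← b.sum_repr (F.presheaf.map (homOfLE inf_le_left).op σ)]
  rw [comparison_sum α hadd]
  refine Finset.sum_congr rfl fun k _ ↦ ?_
  rw [hsmul _ _ _ P hP, AlgPoints.evalOrZero_of_mem _ hP, hb, IsSectionFrame.basis_apply,
    hres U (U' ⊓ U) inf_le_right (s k) P hP]

/-- **Two comparison data agree through the frame-matching fibre map** (uniqueness of `u^an`,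
algebraic half): if `α` (into `V`) and `β` (into `W`) are both additive, `𝒪_X`-linear and
restriction-compatible comparison maps for `F`, `s` is an algebraic frame over `U ∋ P`, and the
linear map `Φ : V P →ₗ W P` satisfies `Φ (α(s_k)(P)) = β(s_k)(P)` for all `k`, then
`Φ (α(σ)(P)) = β(σ)(P)` for every section `σ` over every open `U' ∋ P`.
[cite: SerreGAGA1956, §3 n°9 Déf. 2 and Prop. 10] -/
theorem comparison_eq_of_frame (α : ∀ U : X.left.Opens, Γ(F, U) → ∀ P : ComplexPoints X, V P)
    (β : ∀ U : X.left.Opens, Γ(F, U) → ∀ P : ComplexPoints X, W P)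
    (hadd : ∀ (U : X.left.Opens) (σ τ : Γ(F, U)) (P : ComplexPoints X),
      α U (σ + τ) P = α U σ P + α U τ P)
    (hsmul : ∀ (U : X.left.Opens) (f : Γ(X.left, U)) (σ : Γ(F, U)) (P : ComplexPoints X)
      (h : P.pt ∈ U), α U (f • σ) P = P.eval U h f • α U σ P)
    (hres : ∀ (U W : X.left.Opens) (hWU : W ≤ U) (σ : Γ(F, U)) (P : ComplexPoints X), P.pt ∈ W →
      α W (F.presheaf.map (homOfLE hWU).op σ) P = α U σ P)
    (hadd' : ∀ (U : X.left.Opens) (σ τ : Γ(F, U)) (P : ComplexPoints X),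
      β U (σ + τ) P = β U σ P + β U τ P)
    (hsmul' : ∀ (U : X.left.Opens) (f : Γ(X.left, U)) (σ : Γ(F, U)) (P : ComplexPoints X)
      (h : P.pt ∈ U), β U (f • σ) P = P.eval U h f • β U σ P)
    (hres' : ∀ (U W : X.left.Opens) (hWU : W ≤ U) (σ : Γ(F, U)) (P : ComplexPoints X), P.pt ∈ W →
      β W (F.presheaf.map (homOfLE hWU).op σ) P = β U σ P)
    {U : X.left.Opens} {s : Fin r → Γ(F, U)} (hs : IsSectionFrame F U s) {P : ComplexPoints X}
    (h : P.pt ∈ U) (Φ : V P →ₗ[ℂ] W P) (hΦ : ∀ k, Φ (α U (s k) P) = β U (s k) P)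
    {U' : X.left.Opens} (σ : Γ(F, U')) (h' : P.pt ∈ U') :
    Φ (α U' σ P) = β U' σ P := by
  rw [comparison_expand α hadd hsmul hres hs σ h' h, comparison_expand β hadd' hsmul' hres' hs σ h' h,
    map_sum]
  refine Finset.sum_congr rfl fun k _ ↦ ?_
  rw [map_smul, hΦ]

end Summit.HodgeConjecture.HodgeConjecture.Theorems

end
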